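import Summits.QuantumFields.YangMills.Theorems.Y2BridgeKing
import HarnessLib

/-!
# Route `BalabanLadder`, crux `ROT` (stmt-QuantumFields-20042): vocabulary of the INFINITESIMAL WARD ROUTE (lane B)

Route-posited objects (D-0016 `<Route><Crux>…Defs` file) of the second prover lane `ym-rot-20042-p2` on the registered stub
`stub_kingLimit : KingLimit` (skeleton v4 «king-limit», `Cruxes/ROT/Lines/birth.lean` 824d5540ff52cfd5; stub text
`Theorems/BalabanLadderROTDefs.lean` §3).  Lane A (`ym-spine-20042-p1`) works C. King's FINITE-ANGLE route (Pythagorean rotations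
realised as sublattice maps); lane B works the INFINITESIMAL generator — the rotation Ward identity of the lattice theory with its
breaking term made explicit.

The crux's conclusion `LatticeRotWard G r a` (`Theorems/Y2BridgeKing.lean`) asks that the centred, `a⁻⁴`-renormalised lattice
`n`-point distributions `Λ_k = latticeDist …` annihilate, in the limit, the derivative `D F = dF·Y` of every test function of the
germ class along the generator `(Y x)ᵢ = xᵢ⁰ e₁ − xᵢ¹ e₀` of the rotations of the `(x₀,x₁)`-plane.  Summation by parts on
`(ℤ⁴)ⁿ` moves the generator from the test function onto the centred moment function
`W_k(x) = ∫ ∏ᵢ (tr F²(τ_{xᵢ}U) − m) dμ` (`torusMoment`): up to a second-order Taylor remainder of size `O(a_k)·(collar norms)`,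
`Λ_k(D F) = − Σ_x (𝓛 W_k)(x) · F(a_k x)`, where `𝓛 = Σᵢ (xᵢ⁰ ∇⁻_{i,1} − xᵢ¹ ∇⁻_{i,0})` is the LATTICE ANGULAR MOMENTUM
(backward differences) acting on all slots (`latAngMom`).  By linearity of the integral `∇⁻_{i,μ} W_k` is the moment with the
local field in slot `i` replaced by its lattice derivative — the INSERTION of the rotation-breaking field (in the continuum the
corresponding insertion has zero expectation by E1).  This file only names the objects: `unitVec`, `contUnitVec`, `scaleSite`,
`bdiff`, `latAngMom`, `angularSum`, `latGen` (§1) and the Ward forms `LatticeAngularWard G r a` of the crux's conclusion,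
`KingAngular` of the registered stub, `ROTAngular` of the crux (§2).  The identities, the theorem
`Λ_k(D F) + Σ_x (𝓛 W_k)(x) F(a_k x) → 0` and the equivalences `LatticeRotWard ⟺ LatticeAngularWard` (under `MomentBounds`),
`KingLimit ⟺ KingAngular`, `ROT ⟺ ROTAngular` are proved in `Theorems/BalabanLadderROTWardSBP.lean`, `…WardTaylor.lean`,
`…WardEquiv.lean`.

NOTHING here is asserted: every `def` is lattice calculus over tree objects or a line statement (the Ward forms are NOT literature
facts and do not restate the crux as a claim; each is proved equivalent to an existing tree statement).

Refs: K. Symanzik, Nucl. Phys. B 226 (1983) 187 (power counting of lattice artefacts); S. Caracciolo, G. Curci, P. Menotti,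
A. Pelissetto, Ann. Phys. 197 (1990) 119 and S. Caracciolo, P. Menotti, A. Pelissetto, Nucl. Phys. B 375 (1992) 195
[corpus: montvay1994 p.425, ref. 3.36] (lattice energy-momentum tensor; restoration of the space-time symmetries holds in
perturbation theory only); K. Osterwalder, R. Schrader, Comm. Math. Phys. 31 (1973) §4.2 (infinitesimal form of E1); tree
`Theorems/Y2BridgeKing.lean` (`LatticeRotWard`, `KingClass`), `…StubAssemblyLatticeDist.lean` (`latticeDist`, `torusMoment`),
`Theorems/BalabanLadderROTDefs.lean` §3 (`KingLimit`).
-/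

set_option autoImplicit false

noncomputable section

open scoped SchwartzMap BigOperators
open MeasureTheory Filter Topology
open Literature.MathematicalPhysics.QuantumFieldTheory Literature.MathematicalPhysics.QuantumLattice
open Literature.MathematicalPhysics.AQFT
open Literature.Probability.LatticeModels (box Site)
open Summit.QuantumFields.YangMills.Cruxes.OSLegsFromFemtoAndGap.DlrCollarTransfer (MomentBounds6 LowerBounds)
open Summit.QuantumFields.YangMills.Cruxes.OSLegsAtWeakCouplingC.Sketch (Separated SmallDiam)
open Summit.QuantumFields.YangMills.Theorems.OSLegsFromFemtoAndGap (torusMoment)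
open Summit.QuantumFields.YangMills.Theorems.NPointIsotropy.Negative (E4)

namespace Summit.QuantumFields.YangMills.Theorems.ROT.Ward

/-! ## §1 Lattice calculus on `(ℤ⁴)ⁿ`: unit vectors, scaling, backward differences, the lattice angular momentum -/

section LatticeCalculus

variable {n : ℕ}

/-- The unit lattice vector of `(ℤ⁴)ⁿ` in slot `i`, direction `μ`. -/
def unitVec (i : Fin n) (μ : Fin 4) : Fin n → Site 4 :=
  Pi.single i (Pi.single μ 1)

/-- The matching unit vector of `(ℝ⁴)ⁿ` in slot `i`, direction `μ`. -/
def contUnitVec (i : Fin n) (μ : Fin 4) : Fin n → E4 :=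
  Pi.single i (EuclideanSpace.single μ 1)

/-- The lattice multi-site `x` read at spacing `a`: the configuration `(a xᵢ)ᵢ` of `(ℝ⁴)ⁿ`. -/
def scaleSite (a : ℝ) (x : Fin n → Site 4) : Fin n → E4 := fun j => a • siteToE (x j)

/-- Backward difference of a lattice function in slot `i`, direction `μ`: `(∇⁻_{i,μ} W)(x) = W(x) − W(x − e_{i,μ})`. -/
def bdiff (i : Fin n) (μ : Fin 4) (W : (Fin n → Site 4) → ℝ) (x : Fin n → Site 4) : ℝ :=
  W x - W (x - unitVec i μ)

/-- **The lattice angular momentum** of the `(x₀,x₁)`-plane acting on every slot of a lattice function: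
`(𝓛 W)(x) = Σᵢ (xᵢ⁰ ∇⁻_{i,1} W − xᵢ¹ ∇⁻_{i,0} W)(x)`. -/
def latAngMom (W : (Fin n → Site 4) → ℝ) (x : Fin n → Site 4) : ℝ :=
  ∑ i, ((x i 0 : ℝ) * bdiff i 1 W x - (x i 1 : ℝ) * bdiff i 0 W x)

/-- **The angular insertion functional** of a lattice weight `W` at spacing `a` on the torus of half-side `L`:
`Φ ↦ Σ_{x ∈ (box L)ⁿ} (𝓛 W)(x) · Φ(a x)`. -/
def angularSum (W : (Fin n → Site 4) → ℝ) (L : ℕ) (a : ℝ) (Φ : (Fin n → E4) → ℂ) : ℂ :=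
  ∑ x ∈ Fintype.piFinset (fun _ : Fin n => box 4 L), ((latAngMom W x : ℝ) : ℂ) * Φ (scaleSite a x)

/-- **The lattice generator on test functions**: `E_a Φ (x) = Σᵢ (xᵢ⁰ (Φ(a x + a e_{i,1}) − Φ(a x)) − xᵢ¹ (Φ(a x + a e_{i,0}) − Φ(a x)))`. -/
def latGen (a : ℝ) (Φ : (Fin n → E4) → ℂ) (x : Fin n → Site 4) : ℂ :=
  ∑ i, (((x i 0 : ℝ) : ℂ) * (Φ (scaleSite a (x + unitVec i 1)) - Φ (scaleSite a x)) -
    ((x i 1 : ℝ) : ℂ) * (Φ (scaleSite a (x + unitVec i 0)) - Φ (scaleSite a x)))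

/-! ### Coordinates and scaling -/

end LatticeCalculus

/-! ## §2 The Ward (insertion) forms of the crux's conclusion, of the registered stub, of the crux -/

section Binder

variable (G : Type) [Group G] [TopologicalSpace G] [IsTopologicalGroup G] [CompactSpace G]
  [MeasurableSpace G] [BorelSpace G] (r : LatticeRep G) (a : ℝ → ℝ)

/-- **`LatticeAngularWard G r a` — E1 in lattice WARD form** (same binders as `LatticeRotWard G r a`; conclusion: the angular
insertion `Σ_x (𝓛 W_k)(x) F(a_k x)` of the centred torus moment function tends to `0`). -/
def LatticeAngularWard : Prop :=
  ∀ (sch : SpeciesScheme (YMSpecies G)), (∀ k, sch.a k = a (sch.β k)) → Tendsto sch.β atTop atTop →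
    (∀ k, 0 ≤ sch.β k ∧ sch.a k ≤ 1 / 24 ∧ 14 ≤ sch.L k ∧ (sch.a k)⁻¹ * (sch.a k)⁻¹ ≤ sch.L k) →
      ∃ r₀ : ℝ, 0 < r₀ ∧ ∀ (n : ℕ), 2 ≤ n → ∀ F : 𝓢((Fin n → E4), ℂ), IsOffDiagonal F →
        HasCompactSupport (F : (Fin n → E4) → ℂ) →
        (∃ δ : ℝ, 0 < δ ∧ tsupport (F : (Fin n → E4) → ℂ) ⊆ Separated n δ) →
        tsupport (F : (Fin n → E4) → ℂ) ⊆ SmallDiam n r₀ →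
        Tendsto (fun k => angularSum
          (torusMoment r.ρ (sch.β k) (sch.L k) r.curvature.F (wilsonTorusMean r.ρ (sch.β k) (sch.L k) r.curvature.F))
          (sch.L k) (sch.a k) F) atTop (𝓝 0)

end Binder

/-- **`KingAngular` — the registered stub `stub_kingLimit : KingLimit` in Ward form**: for every compact simple `G`, every `r` and
every positive unit map `a → 0` carrying `MomentBounds6 G r a`, the angular insertion vanishes along every admissible scheme on the germ
(`LatticeAngularWard G r a`).  Equivalent to `KingLimit` (`kingLimit_iff_kingAngular`). -/
def KingAngular : Prop :=
  ∀ (G : Type) [Group G] [TopologicalSpace G] [IsTopologicalGroup G] [CompactSpace G],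
    IsCompactSimpleLieGroup G → letI : MeasurableSpace G := borel G; haveI : BorelSpace G := ⟨rfl⟩;
    ∀ (r : LatticeRep G) (a : ℝ → ℝ), (∀ β, 0 < a β) → Tendsto a atTop (𝓝 0) → MomentBounds6 G r a →
      LatticeAngularWard G r a

/-- **`ROTAngular` — the crux `Theses.BalabanLadder.ROT` in Ward form**: its binders verbatim (compact simple `G`, `r`, positive unit
map `a → 0`, `LowerBounds G r a`, `MomentBounds6 G r a`) followed by `LatticeAngularWard G r a` in place of `LatticeRotWard G r a`.
Equivalent to the crux (`Theorems.ROT.Ward.rot_iff_rotAngular`). -/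
def ROTAngular : Prop :=
  ∀ (G : Type) [Group G] [TopologicalSpace G] [IsTopologicalGroup G] [CompactSpace G],
    IsCompactSimpleLieGroup G → letI : MeasurableSpace G := borel G; haveI : BorelSpace G := ⟨rfl⟩;
    ∀ (r : LatticeRep G) (a : ℝ → ℝ), (∀ β, 0 < a β) → Tendsto a atTop (𝓝 0) → LowerBounds G r a → MomentBounds6 G r a →
      LatticeAngularWard G r a

end Summit.QuantumFields.YangMills.Theorems.ROT.Ward

end
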